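import Summits.HubbardSuperconductivity.HubbardSuperconductivity.Theorems.LevyLogBootstrapLevyTransportCrudeFloorRowSums
import HarnessLib

/-!
# Crude floor, part 3: no hop between periodic configurations; the non-periodic mass

Crux `LevyTransport` (stmt-HubbardSuperconductivity-15049, route `LevyLogBootstrap`), input (c) of
the load-bearing stub `stub_logBootstrap` (`Cruxes/LevyTransport/Lines/birth.lean`): the M-UNIFORM
ANCHOR of the Lévy mass at the KLS point `Δ = 0`. The anchor is proved WITHOUT reflection positivity
from long-range order + the `T = 0` infrared bound + a crude Perron–Frobenius floor; this file is one
link of that chain (files `…LevyTransportCrudeFloorHops`, `…RowSums`, `…Periodic`, `…Variational`,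
`…CrudeFloor`, `…AnchorBlocks`, `…AnchorXY`). Model: `H_G(Δ) = xxzHamiltonian 1 G (-1) Δ`
(hard-core bosons; spin ½, label `0` = up = particle), on the torus `G = torusGraph 2 M`.
Sources: H. Tasaki, *Physics and Mathematics of Quantum Many-Body Systems* (2020) §2.4;
E. Lieb, D. Mattis, J. Math. Phys. 3 (1962) 749; T. Kennedy, E. H. Lieb, B. S. Shastry,
Phys. Rev. Lett. 61 (1988) 2582. No definition is introduced; sorry-free.

This file: `ham_apply_eq_zero_of_periodic` (a fixed-point-free relabelling `T` of the sites: two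
`T`-periodic configurations are never one hop apart; registered torus form
`crudeFloor_noPeriodicHop_torus`), the weighted double-sum bound with a vanishing block
(`sum_sum_mul_le_of_vanish`) and `nonPeriodic_mass_ge`: for a normalised nonnegative eigenvector
with `E ≤ -|E(G)|/4` and `|Δ| < 1`, the non-`T`-periodic configurations carry mass
`≥ ((1-|Δ|)/4)²`.
-/

noncomputable section

set_option linter.dupNamespace false

namespace Summit.HubbardSuperconductivity.HubbardSuperconductivity.Theorems.LevyLogBootstrap

open scoped BigOperators Matrix ComplexOrder
open Matrix Finset Complex
open Literature.MathematicalPhysics.QuantumLattice Literature.Probability.LatticeModels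
open Literature.MathematicalPhysics.QuantumLattice.LiebMattis
open Summit.AtomisticToContinuum.BoseEinsteinCondensation.Theorems.BECStronglyRayleighSectorPerron
open Summit.HubbardSuperconductivity.HubbardSuperconductivity.Theorems.PolyaSchurPairBoson

namespace CrudeFloor

variable {Λ : Type*} [Fintype Λ] [DecidableEq Λ]

/-! ### Periodic configurations carry no hops; the non-periodic mass from the kinetic energy -/

section Periodic

variable (G : SimpleGraph Λ) [DecidableRel G.Adj] (Δ : ℝ)

/-- For spin ½, `(τ a).val = (σ a).val + 1` forces `σ a = 0` and `τ a = 1`. [folklore] -/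
theorem fin_two_of_val_succ {k l : Fin 2} (h : l.val = k.val + 1) : k = 0 ∧ l = 1 := by
  rcases fin_two_eq_zero_or_one k with rfl | rfl <;> rcases fin_two_eq_zero_or_one l with rfl | rfl <;>
    simp_all

/-- **No hop connects two `T`-periodic configurations** (`T` a fixed-point-free map of the sites,
e.g. a nonzero translation of a torus): if `σ ≠ τ` are both `T`-periodic then `H_{στ} = 0`.
A hop across `{a,b}` changes the occupation of `a` but not of `T a ∉ {a, b}`, and `T a = b` is
excluded because the two ends of a hop have different occupations. [folklore] -/
theorem ham_apply_eq_zero_of_periodic {T : Λ → Λ} (hT : ∀ z, T z ≠ z) {σ τ : TensorIndex Λ 2}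
    (hσ : ∀ z, σ (T z) = σ z) (hτ : ∀ z, τ (T z) = τ z) (hστ : σ ≠ τ) :
    (xxzHamiltonian 1 G (-1) Δ : Op Λ 2) σ τ = 0 := by
  obtain ⟨happ, -, -, -⟩ := ham_entries G Δ
  rw [happ σ τ hστ, neg_eq_zero]
  by_contra hne
  rw [heisenbergHamiltonian_apply, Complex.ofReal_one, one_mul] at hne
  obtain ⟨e, he, hne'⟩ := Finset.exists_ne_zero_of_sum_ne_zero hne
  revert he hne'
  induction e using Sym2.ind with
  | h a b =>
    intro he hne'
    have hab : a ≠ b := by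
      rw [SimpleGraph.mem_edgeFinset, SimpleGraph.mem_edgeSet] at he
      exact he.ne
    rw [spinDotSym_mk] at hne'
    -- the hop, in either orientation
    have key : ∀ {a b : Λ}, a ≠ b →
        (τ a).val = (σ a).val + 1 → (σ b).val = (τ b).val + 1 →
        (∀ z, z ≠ a → z ≠ b → σ z = τ z) → False := by
      intro a b _ h1 h2 hrest
      obtain ⟨hσa, hτa⟩ := fin_two_of_val_succ h1
      obtain ⟨hτb, hσb⟩ := fin_two_of_val_succ h2
      by_cases hTa : T a = b
      · have := hσ a
        rw [hTa, hσb, hσa] at this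
        exact absurd this (by decide)
      · have h3 := hrest (T a) (hT a) hTa
        rw [hσ a, hτ a, hσa, hτa] at h3
        exact absurd h3 (by decide)
    rcases hop_of_spinDot_apply_ne_zero 1 hab hστ hne' with ⟨h1, h2, hrest⟩ | ⟨h1, h2, hrest⟩
    · exact key hab h1 h2 hrest
    · exact key hab.symm h1 h2 hrest

/-- **Weighted double sums with a vanishing block** (the combinatorial core of the kinetic-energy
bound): for a symmetric nonnegative kernel `w` with row sums `≤ R`, vanishing on pairs of `P`-sites,
and a nonnegative vector `u`, `Σ_{σ,τ} w_{στ} u_σ u_τ ≤ R (t·Σ_{σ∉P} u_σ² + (Σ_τ u_τ²)/t)` for every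
`t > 0` (every nonzero term has an endpoint outside `P`; then `2u_σu_τ ≤ t u_σ² + u_τ²/t`).
[folklore] -/
theorem sum_sum_mul_le_of_vanish {ι : Type*} [Fintype ι] [DecidableEq ι] (w : ι → ι → ℝ)
    (hw0 : ∀ σ τ, 0 ≤ w σ τ) (hws : ∀ σ τ, w σ τ = w τ σ) {R : ℝ} (hrow : ∀ σ, ∑ τ, w σ τ ≤ R)
    (u : ι → ℝ) (hu : ∀ σ, 0 ≤ u σ) (P : ι → Prop) [DecidablePred P]
    (hP : ∀ σ τ, P σ → P τ → w σ τ = 0) {t : ℝ} (ht : 0 < t) :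
    ∑ σ, ∑ τ, w σ τ * (u σ * u τ) ≤
      R * (t * ∑ σ ∈ Finset.univ.filter (fun σ => ¬P σ), u σ ^ 2 + (∑ τ, u τ ^ 2) / t) := by
  set S := Finset.univ.filter (fun σ : ι => ¬P σ) with hS
  set Q : ℝ := ∑ σ ∈ S, ∑ τ, w σ τ * (u σ * u τ) with hQ
  set ε2 : ℝ := ∑ σ ∈ S, u σ ^ 2 with hε2
  set m : ℝ := ∑ τ, u τ ^ 2 with hm
  have hcol : ∀ τ, ∑ σ, w σ τ ≤ R := fun τ => by
    rw [Finset.sum_congr rfl fun σ _ => hws σ τ]; exact hrow τ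
  -- the bound on `Q`
  have hterm : ∀ σ τ, w σ τ * (u σ * u τ) ≤
      (w σ τ * (t * u σ ^ 2) + w σ τ * (u τ ^ 2 / t)) / 2 := by
    intro σ τ
    have h : 0 ≤ w σ τ * ((t * u σ - u τ) ^ 2 / t) := mul_nonneg (hw0 σ τ) (by positivity)
    have e : w σ τ * ((t * u σ - u τ) ^ 2 / t) =
        w σ τ * (t * u σ ^ 2) + w σ τ * (u τ ^ 2 / t) - 2 * (w σ τ * (u σ * u τ)) := by
      field_simp
      ring
    linarith
  have hA : ∑ σ ∈ S, ∑ τ, w σ τ * (t * u σ ^ 2) ≤ t * R * ε2 := by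
    calc ∑ σ ∈ S, ∑ τ, w σ τ * (t * u σ ^ 2) = ∑ σ ∈ S, (t * u σ ^ 2) * ∑ τ, w σ τ := by
          refine Finset.sum_congr rfl fun σ _ => ?_
          rw [Finset.mul_sum]
          exact Finset.sum_congr rfl fun τ _ => mul_comm _ _
      _ ≤ ∑ σ ∈ S, (t * u σ ^ 2) * R :=
          Finset.sum_le_sum fun σ _ => mul_le_mul_of_nonneg_left (hrow σ) (by positivity)
      _ = t * R * ε2 := by rw [hε2, Finset.mul_sum]; exact Finset.sum_congr rfl fun σ _ => by ring
  have hB : ∑ σ ∈ S, ∑ τ, w σ τ * (u τ ^ 2 / t) ≤ R * m / t := by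
    calc ∑ σ ∈ S, ∑ τ, w σ τ * (u τ ^ 2 / t) ≤ ∑ σ, ∑ τ, w σ τ * (u τ ^ 2 / t) :=
          Finset.sum_le_sum_of_subset_of_nonneg (Finset.filter_subset _ _) fun σ _ _ =>
            Finset.sum_nonneg fun τ _ => mul_nonneg (hw0 σ τ) (by positivity)
      _ = ∑ τ, (u τ ^ 2 / t) * ∑ σ, w σ τ := by
          rw [Finset.sum_comm]
          refine Finset.sum_congr rfl fun τ _ => ?_
          rw [Finset.mul_sum]
          exact Finset.sum_congr rfl fun σ _ => mul_comm _ _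
      _ ≤ ∑ τ, (u τ ^ 2 / t) * R :=
          Finset.sum_le_sum fun τ _ => mul_le_mul_of_nonneg_left (hcol τ) (by positivity)
      _ = R * m / t := by
          rw [hm, Finset.mul_sum, Finset.sum_div]
          exact Finset.sum_congr rfl fun τ _ => by ring
  have hQle : Q ≤ (t * R * ε2 + R * m / t) / 2 := by
    calc Q ≤ ∑ σ ∈ S, ∑ τ, (w σ τ * (t * u σ ^ 2) + w σ τ * (u τ ^ 2 / t)) / 2 :=
          Finset.sum_le_sum fun σ _ => Finset.sum_le_sum fun τ _ => hterm σ τ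
      _ = (∑ σ ∈ S, ∑ τ, w σ τ * (t * u σ ^ 2) + ∑ σ ∈ S, ∑ τ, w σ τ * (u τ ^ 2 / t)) / 2 := by
          rw [← Finset.sum_add_distrib, Finset.sum_div]
          refine Finset.sum_congr rfl fun σ _ => ?_
          rw [← Finset.sum_add_distrib, Finset.sum_div]
      _ ≤ (t * R * ε2 + R * m / t) / 2 := by linarith
  -- split the outer sum over `P` and `¬P`
  have hsplit : ∑ σ, ∑ τ, w σ τ * (u σ * u τ) =
      ∑ σ ∈ Finset.univ.filter (fun σ => P σ), ∑ τ, w σ τ * (u σ * u τ) + Q := by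
    rw [hQ, hS, ← Finset.sum_filter_add_sum_filter_not Finset.univ P]
  -- the `P` part: only `τ ∉ P` contributes; swap and dominate by `Q`
  have hPpart : ∑ σ ∈ Finset.univ.filter (fun σ => P σ), ∑ τ, w σ τ * (u σ * u τ) ≤ Q := by
    have h1 : ∀ σ ∈ Finset.univ.filter (fun σ => P σ), ∑ τ, w σ τ * (u σ * u τ) =
        ∑ τ ∈ S, w σ τ * (u σ * u τ) := by
      intro σ hσ
      rw [hS, ← Finset.sum_filter_add_sum_filter_not Finset.univ P]
      have hz : ∑ τ ∈ Finset.univ.filter (fun τ => P τ), w σ τ * (u σ * u τ) = 0 :=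
        Finset.sum_eq_zero fun τ hτ => by
          rw [hP σ τ (Finset.mem_filter.1 hσ).2 (Finset.mem_filter.1 hτ).2, zero_mul]
      rw [hz, zero_add]
    rw [Finset.sum_congr rfl h1, Finset.sum_comm]
    refine Finset.sum_le_sum fun τ _ => ?_
    calc ∑ σ ∈ Finset.univ.filter (fun σ => P σ), w σ τ * (u σ * u τ)
        ≤ ∑ σ, w σ τ * (u σ * u τ) :=
          Finset.sum_le_sum_of_subset_of_nonneg (Finset.filter_subset _ _) fun σ _ _ =>
            mul_nonneg (hw0 σ τ) (mul_nonneg (hu σ) (hu τ))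
      _ = ∑ σ, w τ σ * (u τ * u σ) := Finset.sum_congr rfl fun σ _ => by rw [hws σ τ]; ring
  rw [hsplit]
  have : R * (t * ε2 + m / t) = t * R * ε2 + R * m / t := by ring
  rw [this]
  linarith

/-- **Kinetic energy forces non-periodicity.** Let `φ ≥ 0` be a normalised eigenvector of
`H_G(Δ)` (`|Δ| < 1`) with eigenvalue `E ≤ -|E(G)|/4` (the energy of the fully polarised product
state), on a graph with at least one edge, and `T` a fixed-point-free map of the sites. Then the
`T`-periodic configurations do not carry the whole state:
`Σ_{σ not T-periodic} φ(σ)² ≥ ((1 - |Δ|)/4)²`. [folklore] -/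
theorem nonPeriodic_mass_ge {φ : TensorIndex Λ 2 → ℂ} (hnn : ∀ σ, 0 ≤ (φ σ).re ∧ (φ σ).im = 0)
    (hnorm : ∑ σ, (φ σ).re ^ 2 = 1) {E : ℝ}
    (hHφ : (xxzHamiltonian 1 G (-1) Δ : Op Λ 2) *ᵥ φ = (E : ℂ) • φ) (hΔ : |Δ| < 1)
    (hB : 0 < G.edgeFinset.card) (hE : E ≤ -(G.edgeFinset.card : ℝ) / 4)
    {T : Λ → Λ} (hT : ∀ z, T z ≠ z) :
    ((1 - |Δ|) / 4) ^ 2 ≤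
      ∑ σ ∈ Finset.univ.filter (fun σ : TensorIndex Λ 2 => ¬ ∀ z, σ (T z) = σ z), (φ σ).re ^ 2 := by
  obtain ⟨happ, hreal, hsymm, hoff⟩ := ham_entries G Δ
  set H : Op Λ 2 := xxzHamiltonian 1 G (-1) Δ with hHdef
  set B : ℝ := (G.edgeFinset.card : ℝ) with hBdef
  have hB' : (0 : ℝ) < B := by rw [hBdef]; exact_mod_cast hB
  set u : TensorIndex Λ 2 → ℝ := fun σ => (φ σ).re with hu
  set w : TensorIndex Λ 2 → TensorIndex Λ 2 → ℝ := fun σ τ => if σ = τ then 0 else (-(H σ τ)).re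
    with hw
  set ε2 : ℝ := ∑ σ ∈ Finset.univ.filter (fun σ : TensorIndex Λ 2 => ¬ ∀ z, σ (T z) = σ z), (φ σ).re ^ 2
    with hε2
  have him : ∀ a b, (H a b).im = 0 := fun a b => by
    have h := congrArg Complex.im (hreal a b)
    rw [Complex.star_def, Complex.conj_im] at h
    linarith
  -- the energy as a real double sum
  have hE_eq : E = ∑ σ, ∑ τ, (H σ τ).re * (u σ * u τ) := by
    have h1 : star φ ⬝ᵥ (H *ᵥ φ) = (E : ℂ) * (star φ ⬝ᵥ φ) := by
      rw [hHφ, dotProduct_smul, smul_eq_mul]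
    have hφφ : star φ ⬝ᵥ φ = ((∑ σ, (φ σ).re ^ 2 : ℝ) : ℂ) := by
      rw [dotProduct]
      push_cast
      refine Finset.sum_congr rfl fun σ _ => ?_
      rw [Pi.star_apply]
      set r : ℝ := (φ σ).re with hr
      have hφr : φ σ = (r : ℂ) := Complex.ext (by rw [hr, Complex.ofReal_re]) (by
        rw [(hnn σ).2, Complex.ofReal_im])
      rw [hφr, Complex.star_def, Complex.conj_ofReal]
      ring_nf
    rw [hφφ, hnorm] at h1
    push_cast at h1
    rw [mul_one] at h1
    have h2 := congrArg Complex.re h1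
    rw [Complex.ofReal_re] at h2
    rw [← h2, dotProduct, Complex.re_sum]
    refine Finset.sum_congr rfl fun σ _ => ?_
    rw [Pi.star_apply, mulVec, dotProduct, Finset.mul_sum, Complex.re_sum]
    refine Finset.sum_congr rfl fun τ _ => ?_
    have hsre : (star (φ σ)).re = (φ σ).re := by rw [Complex.star_def, Complex.conj_re]
    have hsim : (star (φ σ)).im = 0 := by rw [Complex.star_def, Complex.conj_im, (hnn σ).2, neg_zero]
    rw [Complex.mul_re, hsim, zero_mul, sub_zero, hsre, Complex.mul_re, him, (hnn τ).2, mul_zero,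
      sub_zero]
    simp only [hu]
    ring
  -- split off the diagonal
  have hsplit : ∑ σ, ∑ τ, (H σ τ).re * (u σ * u τ) =
      ∑ σ, (H σ σ).re * (u σ * u σ) - ∑ σ, ∑ τ, w σ τ * (u σ * u τ) := by
    rw [← Finset.sum_sub_distrib]
    refine Finset.sum_congr rfl fun σ _ => ?_
    rw [← Finset.add_sum_erase _ _ (Finset.mem_univ σ), ← Finset.add_sum_erase _ (fun τ => w σ τ * _)
      (Finset.mem_univ σ)]
    simp only [hw, if_pos rfl, zero_mul, zero_add]
    have : ∑ τ ∈ Finset.univ.erase σ, (if σ = τ then 0 else (-(H σ τ)).re) * (u σ * u τ) =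
        -∑ τ ∈ Finset.univ.erase σ, (H σ τ).re * (u σ * u τ) := by
      rw [← Finset.sum_neg_distrib]
      refine Finset.sum_congr rfl fun τ hτ => ?_
      rw [if_neg (Finset.ne_of_mem_erase hτ).symm, Complex.neg_re]
      ring
    rw [this]
    ring
  -- the diagonal part is small
  have hdiag : ∑ σ, (H σ σ).re * (u σ * u σ) ≥ -(|Δ| * B / 4) := by
    have hterm : ∀ σ, -(|Δ| * B / 4) * (u σ * u σ) ≤ (H σ σ).re * (u σ * u σ) := by
      intro σ
      refine mul_le_mul_of_nonneg_right ?_ (mul_self_nonneg _)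
      have h1 := abs_re_ham_diag_le G Δ σ
      have h2 := neg_abs_le ((H σ σ).re)
      rw [← hBdef] at h1
      linarith
    have h := Finset.sum_le_sum fun σ (_ : σ ∈ Finset.univ) => hterm σ
    rw [← Finset.mul_sum] at h
    have hn : ∑ σ, u σ * u σ = 1 := by
      rw [← hnorm]; exact Finset.sum_congr rfl fun σ _ => by simp only [hu]; ring
    rw [hn, mul_one] at h
    exact h
  -- the off-diagonal part obeys the vanishing-block bound
  have hw0 : ∀ σ τ, 0 ≤ w σ τ := fun σ τ => by
    simp only [hw]
    split_ifs with h
    · exact le_rfl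
    · rw [Complex.neg_re]; linarith [hoff σ τ h]
  have hws : ∀ σ τ, w σ τ = w τ σ := fun σ τ => by
    simp only [hw]
    by_cases h : σ = τ
    · subst h; rfl
    · rw [if_neg h, if_neg (Ne.symm h), hsymm σ τ]
  have hrow : ∀ σ, ∑ τ, w σ τ ≤ B / 2 := fun σ => by
    have h := sum_re_neg_ham_offdiag_le G Δ σ
    rw [← Finset.add_sum_erase _ _ (Finset.mem_univ σ)]
    simp only [hw, if_pos rfl, zero_add]
    rw [← hBdef] at h
    refine le_trans (le_of_eq (Finset.sum_congr rfl fun τ hτ => ?_)) h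
    rw [if_neg (Finset.ne_of_mem_erase hτ).symm]
  have hu0 : ∀ σ, 0 ≤ u σ := fun σ => (hnn σ).1
  have hP : ∀ σ τ : TensorIndex Λ 2, (∀ z, σ (T z) = σ z) → (∀ z, τ (T z) = τ z) → w σ τ = 0 := by
    intro σ τ hσ hτ
    simp only [hw]
    split_ifs with h
    · rfl
    · have h0 := ham_apply_eq_zero_of_periodic G Δ hT hσ hτ h
      rw [← hHdef] at h0
      rw [h0, neg_zero, Complex.zero_re]
  set δ : ℝ := 1 - |Δ| with hδ
  have hδ0 : 0 < δ := by rw [hδ]; linarith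
  have ht : (0 : ℝ) < 4 / δ := by positivity
  have hmain := sum_sum_mul_le_of_vanish w hw0 hws hrow u hu0 (fun σ => ∀ z, σ (T z) = σ z) hP ht
  have hm : ∑ τ, u τ ^ 2 = 1 := hnorm
  have hε2' : ∑ σ ∈ Finset.univ.filter (fun σ : TensorIndex Λ 2 => ¬ ∀ z, σ (T z) = σ z), u σ ^ 2 = ε2 := by
    rw [hε2]
  rw [hm, hε2'] at hmain
  -- assemble: `B/4 ≤ -E ≤ |Δ|B/4 + (B/2)(t ε² + 1/t)`
  have h1 : -E ≤ |Δ| * B / 4 + B / 2 * (4 / δ * ε2 + 1 / (4 / δ)) := by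
    rw [hE_eq, hsplit]
    linarith
  have h2 : B / 4 ≤ -E := by linarith
  have h3 : (1 : ℝ) / (4 / δ) = δ / 4 := by field_simp
  rw [h3] at h1
  -- divide by `B/4 > 0`
  have h4 : δ / 4 ≤ 4 / δ * ε2 := by
    have : B / 4 * δ ≤ B / 4 * (2 * (4 / δ * ε2 + δ / 4)) := by
      have := h2.trans h1
      rw [hδ] at this ⊢
      nlinarith
    have h5 : δ ≤ 2 * (4 / δ * ε2 + δ / 4) := le_of_mul_le_mul_left this (by positivity)
    linarith
  have h6 : δ / 4 * δ ≤ 4 / δ * ε2 * δ := mul_le_mul_of_nonneg_right h4 hδ0.le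
  rw [show 4 / δ * ε2 * δ = 4 * ε2 by field_simp] at h6
  nlinarith

/-- **Registered form (torus)** of `ham_apply_eq_zero_of_periodic`: configurations periodic
under a nonzero translation of the torus are never connected by a hop of `H_M(Δ)`. [folklore] -/
theorem crudeFloor_noPeriodicHop_torus :
    ∀ (M : ℕ) [NeZero M] (Δ : ℝ) (v : TorusSite 2 M), v ≠ 0 →
      ∀ σ τ : TensorIndex (TorusSite 2 M) 2, (∀ z, σ (z + v) = σ z) → (∀ z, τ (z + v) = τ z) → σ ≠ τ →
        (xxzHamiltonian 1 (torusGraph 2 M) (-1) Δ : Op (TorusSite 2 M) 2) σ τ = 0 :=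
  fun M _ Δ v hv _ _ hσ hτ hστ =>
    ham_apply_eq_zero_of_periodic (torusGraph 2 M) Δ (T := fun z => z + v)
      (fun z h => hv (by simpa using h)) hσ hτ hστ

end Periodic

end CrudeFloor

end Summit.HubbardSuperconductivity.HubbardSuperconductivity.Theorems.LevyLogBootstrap

end
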